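/-
Copyright: derived here (Resolution Observatory cell `pub-rosobs`, carver gen 57). AI-written Lean; AI review is weaker than expert
review.  Companion file of the cell's POLYNOMIAL weighted-centre model `W(f)`: the WEIGHT ARITHMETIC of engine 1's THEOREM Θ(xxvii)
and of the feeder exclusions of its PIN lemmas / THEOREM K6 (THEOREM-PIN-eng1-g38 §0, §1, §3 (iv), §4 (iv), §5), with the degree `ρ`
and `w* = pρ` SYMBOLIC.  Instrument — NOT a resolution theorem and NOT a statement about the invariant of [AbramovichTemkinWlodarczyk2024].
-/
import Mathlib.Data.Rat.Defs
import Mathlib.Data.Finset.Basic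
import Mathlib.Algebra.Order.Field.Basic
import Mathlib.Algebra.Order.BigOperators.Group.Finset
import Mathlib.Algebra.BigOperators.Ring.Finset
import Mathlib.Algebra.BigOperators.Field
import Mathlib.Data.Nat.Prime.Basic
import Mathlib.Tactic.Linarith
import Mathlib.Tactic.NormNum
import Mathlib.Tactic.Positivity
import Mathlib.Tactic.Ring
import Mathlib.Tactic.FieldSimp
import HarnessLib

/-!
# THEOREM Θ(xxvii) — the weight arithmetic of the range `R₇ = [1/(7p), 1/(6p)]` and of the PIN feeder exclusions

Uniform value line: INSTRUMENT — kernel-checked WEIGHT ARITHMETIC for the polynomial weighted-centre model `W(f)` of the cell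
(engine 1's toy model: THEOREM-PIN-eng1-g38, scripts `pins38.py` / `feeders38.py`) — NOT a resolution theorem, NOT a statement
about the Abramovich–Temkin–Włodarczyk invariant, NOT summit progress, and NOT a proof of the PIN LEMMA or of THEOREM Θ(xxvii)
(whose algebra — LEMMA PIN §2, LEMMA S, LEMMA C, the `D`-orders — stays in the notes); AI-written Lean, AI review is weaker than
expert review.  It certifies, symbolically in `r = ρ`, `u = w* = pρ` and `p`, every finite weight-bookkeeping step the notes use.

## Dictionary (notes ↔ this file)

* `U = {5/24, 2/9, 1/4, 1/3, 1/2}` = the classes `F′, N′, W, M, V` (T9 LEMMA G); `SlotWt u x := (u ≤ x ≤ 1/5) ∨ x ∈ U` — a legal slot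
  weight `≥ w* = u` ((R0)); the first alternative is "dense".
* Regimes (`regime7_facts`, `regimeNat_lower`, `regime1_lower`, `regime_inclusions`): on `R₇`: `1/7 ≤ u ≤ 1/6`, `0 < r ≤ 1/42`; on
  `R♮ = (1/(8p+4), 1/(6p)]`: `1/4 − r < 2u`; on `R₁ = (1/(10p+5), 1/(6p)]`: `1/5 − r < 2u`; `R₇ ⊂ R♮ ⊂ R₁`.  Every lemma below carries
  exactly the primitive inequalities it uses, so it applies on the largest regime where they hold.
* §1 THE PIN TABLE: a cofactor of a pin of a `c`-slot (`c ∈ U`) weighs `≥ c`, hence is a `U`-weight (`slotWt_ge_mem_U`); the multisets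
  of `U`-weights `≥ c` with sum `1 − c` are `{5/24, 1/4, 1/3}` (`c = F′`), `{2/9, 2/9, 1/3}` (`N′`), `{1/4,1/4,1/4}`, `{1/4, 1/2}` (`W`),
  `{1/3, 1/3}` (`M`), `{1/2}` (`V`) and nothing else (`pin_one`, `pin_two`, `pin_three`, `pin_four_le`); a slot of weight exactly `1/5`
  is pinned only by quintics in the class `1/5` (`pin_fifth_*`).
* §0 SINGLE IMAGES: on `R₁` the `D`-image of a dense slot is a linear form in ONE dense class (`dense_image_not_U`, `image_lt_sum`);
  on `R♮`: `W` has no legal image (`not_slotWt_quarter_sub` + `image_lt_sum`), `F′ ↦ 5/24 − r` (never in `U`; dense iff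
  `1/120 ≤ r`), `N′ ↦ 2/9 − r` (in `U` iff `r = 1/72`; dense iff `1/45 ≤ r`) (`Fprime_image`, `Nprime_image`).
* §3 (iv) FEEDERS of `F′`/`N′` (`feeder_single_U`, `feeder_Cminus_U`, `feeder_Cminus_UU`, `feeder_UU`, `feeder_UUU`): the four
  shapes of a would-be feeder term are weight-infeasible for `0 < r ≤ 1/42`.  [Remark: the notes' line "`(2/9 − ρ) + 5/24 > 1/2 − ρ`"
  is FALSE as arithmetic (`31/72 < 1/2`); the exclusion of the shape `C⁻·U` nevertheless holds, by `feeder_Cminus_U` (the `U`-part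
  would have to weigh `w_y − c ∈ {1/72, 1/36, 1/24, 1/9, 1/8, 7/24, 5/18}`, none of which is a `U`-weight).]
* §4 (iv) FEEDERS of a dense class `w ∈ (1/6, 1/5]` (`sum_ge_card_mul_sub`, `M_feed_lt_sum`, `V_feed_pair_ne`, `V_feed_lt_sum`,
  `not_slotWt_third_sub`, `not_slotWt_half_sub`).
* §5 ORDER BOUNDS on `R₇`: the `D`-terms of an `M`-slot are products of two dense slots (`M_term_*`), those of a `V`-slot are `M′·x`
  with `x = 1/6 − r`, three dense slots, or `F′·a·b` (`V_term_*`); the bound identities `orderBound_M`, `orderBound_V₁/₂/₃`;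
  `e ≥ 2` is excluded by `one_le_sq_mul`.
* §5 DEFICITS + COUNT (`Kind`, `deficit`, `order_sum_le`, **`order_sum_le_pred`**): for factor kinds const / dense-mover (`u ≤ x ≤ 1/6`)
  / `M` / `V` with the order bounds `0`, `(x − u)/r`, `1/(3r) − 2p`, `1/(2r) − 3p` and weights summing to `1`: `Σ o ≤ 1/r − 6p ≤ p`, and
  for `p` prime `≥ 7` the integer `Σ o` is `≤ p − 1` (the endpoint `r = 1/(7p)` cases `p/6, p/3, p/2 ∉ ℕ` and the constant-factor case).

NOT here (engine's modelling): LEMMA PIN itself (§2), LEMMA S / LEMMA C, the `D`-order induction, THEOREM K6 as a statement about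
derivations, the `(11, 1/72)` variant's monomial bookkeeping, BOOTSTRAP⁺.

References (context only; elementary arithmetic decided here): [AbramovichTemkinWlodarczyk2024] §5 (weights of a weighted centre);
[Wlodarczyk2022] (weighted centres in arbitrary characteristic).
-/

namespace Literature.AlgebraicGeometry.Resolution.WeightedBlowup

namespace PinWall

open Finset

/-! ## The weight table `U` and legal slot weights -/

/-- The five non-dense classes `F′ = 5/24, N′ = 2/9, W = 1/4, M = 1/3, V = 1/2` (T9 LEMMA G; notes §0).
[cite: AbramovichTemkinWlodarczyk2024, §5] -/
def U : Finset ℚ := {5/24, 2/9, 1/4, 1/3, 1/2}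

/-- Membership in `U`, unfolded (plumbing). [cite: AbramovichTemkinWlodarczyk2024, §5] -/
theorem mem_U {x : ℚ} : x ∈ U ↔ x = 5/24 ∨ x = 2/9 ∨ x = 1/4 ∨ x = 1/3 ∨ x = 1/2 := by
  simp only [U, mem_insert, mem_singleton]

/-- Every `U`-weight is `≥ 5/24` (plumbing). [cite: AbramovichTemkinWlodarczyk2024, §5] -/
theorem U_ge {x : ℚ} (hx : x ∈ U) : 5/24 ≤ x := by
  rcases mem_U.mp hx with rfl | rfl | rfl | rfl | rfl <;> norm_num

/-- Every `U`-weight is `≤ 1/2` (plumbing). [cite: AbramovichTemkinWlodarczyk2024, §5] -/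
theorem U_le {x : ℚ} (hx : x ∈ U) : x ≤ 1/2 := by
  rcases mem_U.mp hx with rfl | rfl | rfl | rfl | rfl <;> norm_num

/-- A legal slot weight `≥ w* = u` ((R0)): dense (`u ≤ x ≤ 1/5`) or in `U` (notes §0). [cite: AbramovichTemkinWlodarczyk2024, §5] -/
def SlotWt (u x : ℚ) : Prop := (u ≤ x ∧ x ≤ 1/5) ∨ x ∈ U

/-- A legal slot weighs at least `u` (for `u ≤ 1/5`). [cite: AbramovichTemkinWlodarczyk2024, §5] -/
theorem le_of_slotWt {u x : ℚ} (hu : u ≤ 1/5) (h : SlotWt u x) : u ≤ x := by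
  rcases h with ⟨h1, _⟩ | h
  · exact h1
  · linarith [U_ge h]

/-- A legal slot of weight `> 1/5` is a `U`-slot. [cite: AbramovichTemkinWlodarczyk2024, §5] -/
theorem mem_U_of_slotWt_of_gt {u x : ℚ} (h : SlotWt u x) (hx : 1/5 < x) : x ∈ U := by
  rcases h with ⟨_, h2⟩ | h
  · exact absurd h2 (not_le.mpr hx)
  · exact h

/-- A legal slot of weight `≥ 1/5` has weight `1/5` or is a `U`-slot. [cite: AbramovichTemkinWlodarczyk2024, §5] -/
theorem slotWt_ge_fifth {u x : ℚ} (h : SlotWt u x) (hx : 1/5 ≤ x) : x = 1/5 ∨ x ∈ U := by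
  rcases h with ⟨_, h2⟩ | h
  · exact Or.inl (le_antisymm h2 hx)
  · exact Or.inr h

/-! ## Regimes -/

/-- `R₇ = [1/(7p), 1/(6p)]`, `p ≥ 7`: `1/7 ≤ u = pr ≤ 1/6`, `0 < r ≤ 1/42` (notes §0). [cite: AbramovichTemkinWlodarczyk2024, §5] -/
theorem regime7_facts {p r : ℚ} (hp : 7 ≤ p) (h1 : 1 / (7 * p) ≤ r) (h2 : r ≤ 1 / (6 * p)) :
    1/7 ≤ p * r ∧ p * r ≤ 1/6 ∧ 0 < r ∧ r ≤ 1/42 := by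
  have hp0 : 0 < p := by linarith
  rw [div_le_iff₀ (by positivity)] at h1
  rw [le_div_iff₀ (by positivity)] at h2
  have hr : 0 < r := by nlinarith
  refine ⟨by linarith, by linarith, hr, by nlinarith⟩

/-- `R♮ = (1/(8p+4), 1/(6p)]`: `1/4 − r < 2u` — two slots weigh more than `W`'s image (notes §0). [cite: AbramovichTemkinWlodarczyk2024, §5] -/
theorem regimeNat_lower {p r : ℚ} (hp : 0 < p) (h1 : 1 / (8 * p + 4) < r) : 1/4 - r < 2 * (p * r) := by
  rw [div_lt_iff₀ (by positivity)] at h1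
  linarith

/-- `R₁ = (1/(10p+5), 1/(6p)]`: `1/5 − r < 2u` — two slots weigh more than a dense slot's image (notes §0). [cite: AbramovichTemkinWlodarczyk2024, §5] -/
theorem regime1_lower {p r : ℚ} (hp : 0 < p) (h1 : 1 / (10 * p + 5) < r) : 1/5 - r < 2 * (p * r) := by
  rw [div_lt_iff₀ (by positivity)] at h1
  linarith

/-- `R₇ ⊂ R♮ ⊂ R₁`: `1/(10p+5) < 1/(8p+4) < 1/(7p)` (notes §0). [cite: AbramovichTemkinWlodarczyk2024, §5] -/
theorem regime_inclusions {p : ℚ} (hp : 0 < p) : 1 / (8 * p + 4) < 1 / (7 * p) ∧ 1 / (10 * p + 5) < 1 / (8 * p + 4) :=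
  ⟨one_div_lt_one_div_of_lt (by positivity) (by linarith), one_div_lt_one_div_of_lt (by positivity) (by linarith)⟩

/-- On `R₇` the primitive inequalities of `R♮` and `R₁` hold: `1/4 − r < 2u`, `1/5 − r < 2u` (from `1/7 ≤ u`, `0 < r`). [cite: AbramovichTemkinWlodarczyk2024, §5] -/
theorem regime7_lower {u r : ℚ} (hu : 1/7 ≤ u) (hr : 0 < r) : 1/4 - r < 2 * u ∧ 1/5 - r < 2 * u := by
  constructor <;> linarith

/-! ## §1 The pin table -/

/-- A cofactor of a pin of a `c`-slot, `c ∈ U`, weighs `≥ c > 1/5`, hence is a `U`-slot (notes §1). [cite: AbramovichTemkinWlodarczyk2024, §5] -/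
theorem slotWt_ge_mem_U {u c x : ℚ} (hc : c ∈ U) (hx : SlotWt u x) (hcx : c ≤ x) : x ∈ U :=
  mem_U_of_slotWt_of_gt hx (by linarith [U_ge hc])

/-- **Pin table, one cofactor**: only `V·V` (notes §1). [cite: AbramovichTemkinWlodarczyk2024, §5] -/
theorem pin_one {c a : ℚ} (hc : c ∈ U) (ha : a ∈ U) (hca : c ≤ a) (h : a = 1 - c) : c = 1/2 ∧ a = 1/2 := by
  rcases mem_U.mp hc with rfl | rfl | rfl | rfl | rfl <;> rcases mem_U.mp ha with rfl | rfl | rfl | rfl | rfl <;> norm_num at *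

/-- **Pin table, two cofactors** (sorted): only `W·(W V)` and `M·(M M)` (notes §1). [cite: AbramovichTemkinWlodarczyk2024, §5] -/
theorem pin_two {c a b : ℚ} (hc : c ∈ U) (ha : a ∈ U) (hb : b ∈ U) (hca : c ≤ a) (hab : a ≤ b) (h : a + b = 1 - c) :
    (c = 1/4 ∧ a = 1/4 ∧ b = 1/2) ∨ (c = 1/3 ∧ a = 1/3 ∧ b = 1/3) := by
  rcases mem_U.mp hc with rfl | rfl | rfl | rfl | rfl <;> rcases mem_U.mp ha with rfl | rfl | rfl | rfl | rfl <;>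
    rcases mem_U.mp hb with rfl | rfl | rfl | rfl | rfl <;> norm_num at *

/-- **Pin table, three cofactors** (sorted): only `F′·(F′ W M)`, `N′·(N′ N′ M)`, `W·(W W W)` (notes §1; `pins38.py` PART 1).
[cite: AbramovichTemkinWlodarczyk2024, §5] -/
theorem pin_three {c a b d : ℚ} (hc : c ∈ U) (ha : a ∈ U) (hb : b ∈ U) (hd : d ∈ U) (hca : c ≤ a) (hab : a ≤ b) (hbd : b ≤ d)
    (h : a + b + d = 1 - c) :
    (c = 5/24 ∧ a = 5/24 ∧ b = 1/4 ∧ d = 1/3) ∨ (c = 2/9 ∧ a = 2/9 ∧ b = 2/9 ∧ d = 1/3) ∨ (c = 1/4 ∧ a = 1/4 ∧ b = 1/4 ∧ d = 1/4) := by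
  rcases mem_U.mp hc with rfl | rfl | rfl | rfl | rfl <;> rcases mem_U.mp ha with rfl | rfl | rfl | rfl | rfl <;>
    rcases mem_U.mp hb with rfl | rfl | rfl | rfl | rfl <;> rcases mem_U.mp hd with rfl | rfl | rfl | rfl | rfl <;> norm_num at *

/-- **Pin table, four or more cofactors: impossible** — `k ≥ 4` weights `≥ c` sum to `> 1 − c` for `c ∈ U` (notes §1).
[cite: AbramovichTemkinWlodarczyk2024, §5] -/
theorem pin_four_le {c : ℚ} (hc : c ∈ U) {ι : Type*} (s : Finset ι) (f : ι → ℚ) (h4 : 4 ≤ s.card) (hf : ∀ i ∈ s, c ≤ f i) :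
    1 - c < ∑ i ∈ s, f i := by
  have h1 := Finset.card_nsmul_le_sum s f c hf
  rw [nsmul_eq_mul] at h1
  have hc0 := U_ge hc
  have h4' : (4 : ℚ) ≤ s.card := by exact_mod_cast h4
  nlinarith

/-- **The class `1/5`, four cofactors**: all of weight `1/5` (a quintic in the class `1/5`; notes §1, `pins38.py` PART 2).
[cite: AbramovichTemkinWlodarczyk2024, §5] -/
theorem pin_fifth_four {a b d e : ℚ} (ha : a = 1/5 ∨ a ∈ U) (hb : b = 1/5 ∨ b ∈ U) (hd : d = 1/5 ∨ d ∈ U) (he : e = 1/5 ∨ e ∈ U)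
    (h : a + b + d + e = 4/5) : a = 1/5 ∧ b = 1/5 ∧ d = 1/5 ∧ e = 1/5 := by
  have h5 : ∀ x : ℚ, (x = 1/5 ∨ x ∈ U) → 1/5 ≤ x := fun x hx => by
    rcases hx with rfl | hx
    · exact le_rfl
    · linarith [U_ge hx]
  have := h5 a ha; have := h5 b hb; have := h5 d hd; have := h5 e he
  refine ⟨by linarith, by linarith, by linarith, by linarith⟩

/-- The class `1/5`, one cofactor: impossible. [cite: AbramovichTemkinWlodarczyk2024, §5] -/
theorem pin_fifth_one {a : ℚ} (ha : a = 1/5 ∨ a ∈ U) : a ≠ 4/5 := by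
  rcases ha with rfl | ha
  · norm_num
  · rcases mem_U.mp ha with rfl | rfl | rfl | rfl | rfl <;> norm_num

/-- The class `1/5`, two cofactors: impossible. [cite: AbramovichTemkinWlodarczyk2024, §5] -/
theorem pin_fifth_two {a b : ℚ} (ha : a = 1/5 ∨ a ∈ U) (hb : b = 1/5 ∨ b ∈ U) : a + b ≠ 4/5 := by
  rcases ha with rfl | ha <;> rcases hb with rfl | hb
  · norm_num
  · rcases mem_U.mp hb with rfl | rfl | rfl | rfl | rfl <;> norm_num
  · rcases mem_U.mp ha with rfl | rfl | rfl | rfl | rfl <;> norm_num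
  · rcases mem_U.mp ha with rfl | rfl | rfl | rfl | rfl <;> rcases mem_U.mp hb with rfl | rfl | rfl | rfl | rfl <;> norm_num

/-- The class `1/5`, three cofactors: impossible. [cite: AbramovichTemkinWlodarczyk2024, §5] -/
theorem pin_fifth_three {a b d : ℚ} (ha : a = 1/5 ∨ a ∈ U) (hb : b = 1/5 ∨ b ∈ U) (hd : d = 1/5 ∨ d ∈ U) : a + b + d ≠ 4/5 := by
  have hU : ∀ x : ℚ, (x = 1/5 ∨ x ∈ U) → x = 1/5 ∨ x = 5/24 ∨ x = 2/9 ∨ x = 1/4 ∨ x = 1/3 ∨ x = 1/2 := fun x hx => by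
    rcases hx with hx | hx
    · exact Or.inl hx
    · exact Or.inr (mem_U.mp hx)
  rcases hU a ha with rfl | rfl | rfl | rfl | rfl | rfl <;> rcases hU b hb with rfl | rfl | rfl | rfl | rfl | rfl <;>
    rcases hU d hd with rfl | rfl | rfl | rfl | rfl | rfl <;> norm_num

/-- The class `1/5`, five or more cofactors: impossible (`≥ 5 · 1/5 = 1 > 4/5`). [cite: AbramovichTemkinWlodarczyk2024, §5] -/
theorem pin_fifth_five_le {ι : Type*} (s : Finset ι) (f : ι → ℚ) (h5 : 5 ≤ s.card) (hf : ∀ i ∈ s, 1/5 ≤ f i) :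
    4/5 < ∑ i ∈ s, f i := by
  have h1 := Finset.card_nsmul_le_sum s f (1/5) hf
  rw [nsmul_eq_mul] at h1
  have h5' : (5 : ℚ) ≤ s.card := by exact_mod_cast h5
  nlinarith

/-! ## §0 Single images -/

/-- `k` legal slots weigh at least `k·u` (plumbing for all "too many factors" exclusions). [cite: AbramovichTemkinWlodarczyk2024, §5] -/
theorem card_mul_le_sum {u : ℚ} (hu5 : u ≤ 1/5) {ι : Type*} (s : Finset ι) (f : ι → ℚ) (hf : ∀ i ∈ s, SlotWt u (f i)) :
    (s.card : ℚ) * u ≤ ∑ i ∈ s, f i := by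
  have h1 := Finset.card_nsmul_le_sum s f u fun i hi => le_of_slotWt hu5 (hf i hi)
  rwa [nsmul_eq_mul] at h1

/-- A product of `k ≥ 2` legal slots weighs `≥ 2u`; so if `t − r < 2u` it is not a `D`-image of a slot of weight `t`
(notes §0: dense slots on `R₁`, `W, F′, N′` on `R♮`). [cite: AbramovichTemkinWlodarczyk2024, §5] -/
theorem image_lt_sum {u r t : ℚ} (hu0 : 0 ≤ u) (hu5 : u ≤ 1/5) (ht : t - r < 2 * u) {ι : Type*} (s : Finset ι) (f : ι → ℚ)
    (h2 : 2 ≤ s.card) (hf : ∀ i ∈ s, SlotWt u (f i)) : t - r < ∑ i ∈ s, f i := by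
  have h1 := card_mul_le_sum hu5 s f hf
  have h2' : (2 : ℚ) ≤ s.card := by exact_mod_cast h2
  nlinarith

/-- A `U`-slot is heavier than the image `w − r` of a dense slot (`w ≤ 1/5`, `r > 0`) (notes §0, `R₁`). [cite: AbramovichTemkinWlodarczyk2024, §5] -/
theorem dense_image_not_U {r w x : ℚ} (hr : 0 < r) (hw : w ≤ 1/5) (hx : x ∈ U) : x ≠ w - r := by
  have := U_ge hx
  intro h
  linarith

/-- `1/4 − r` is not a legal slot weight for `0 < r ≤ 1/42` (`W` has no single image; notes §0, `R♮`). [cite: AbramovichTemkinWlodarczyk2024, §5] -/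
theorem not_slotWt_quarter_sub {u r : ℚ} (hr0 : 0 < r) (hr : r ≤ 1/42) : ¬ SlotWt u (1/4 - r) := by
  rintro (⟨h1, h2⟩ | h)
  · linarith
  · rcases mem_U.mp h with h | h | h | h | h <;> linarith

/-- `1/3 − r` is not a legal slot weight for `0 < r ≤ 1/42` (notes §4 (iv), §5). [cite: AbramovichTemkinWlodarczyk2024, §5] -/
theorem not_slotWt_third_sub {u r : ℚ} (hr0 : 0 < r) (hr : r ≤ 1/42) : ¬ SlotWt u (1/3 - r) := by
  rintro (⟨h1, h2⟩ | h)
  · linarith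
  · rcases mem_U.mp h with h | h | h | h | h <;> linarith

/-- `1/2 − r` is not a legal slot weight for `0 < r ≤ 1/42` (notes §4 (iv), §5). [cite: AbramovichTemkinWlodarczyk2024, §5] -/
theorem not_slotWt_half_sub {u r : ℚ} (hr0 : 0 < r) (hr : r ≤ 1/42) : ¬ SlotWt u (1/2 - r) := by
  rintro (⟨h1, h2⟩ | h)
  · linarith
  · rcases mem_U.mp h with h | h | h | h | h <;> linarith

/-- **`F′`'s single image `5/24 − r`** (`0 < r ≤ 1/42`, `u ≤ 1/6`): never a `U`-weight; a legal (dense) weight iff `1/120 ≤ r`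
(notes §0, `R♮`). [cite: AbramovichTemkinWlodarczyk2024, §5] -/
theorem Fprime_image {u r : ℚ} (hu : u ≤ 1/6) (hr0 : 0 < r) (hr : r ≤ 1/42) :
    (5/24 - r ∉ U) ∧ (SlotWt u (5/24 - r) ↔ 1/120 ≤ r) := by
  have hU : 5/24 - r ∉ U := fun h => by rcases mem_U.mp h with h | h | h | h | h <;> linarith
  refine ⟨hU, ⟨fun h => ?_, fun h => Or.inl ⟨by linarith, by linarith⟩⟩⟩
  rcases h with ⟨h1, h2⟩ | h
  · linarith
  · exact absurd h hU

/-- **`N′`'s single image `2/9 − r`** (`0 < r ≤ 1/42`, `u ≤ 1/6`): a `U`-weight iff `r = 1/72` (then `= 5/24 = F′`); dense iff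
`1/45 ≤ r` (notes §0, `R♮`). [cite: AbramovichTemkinWlodarczyk2024, §5] -/
theorem Nprime_image {u r : ℚ} (hu : u ≤ 1/6) (hr0 : 0 < r) (hr : r ≤ 1/42) :
    (2/9 - r ∈ U ↔ r = 1/72) ∧ ((u ≤ 2/9 - r ∧ 2/9 - r ≤ 1/5) ↔ 1/45 ≤ r) := by
  refine ⟨⟨fun h => ?_, fun h => ?_⟩, ⟨fun h => by linarith [h.2], fun h => ⟨by linarith, by linarith⟩⟩⟩
  · rcases mem_U.mp h with h | h | h | h | h <;> linarith
  · rw [mem_U, h]; norm_num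

/-! ## §3 (iv) Feeders of `F′` and `N′` (variables in `U ∪ C⁻`, at most one in `C⁻`) -/

/-- Shape "one `U`-variable": `x = w_y − r` with `x, w_y ∈ U` and `0 < r ≤ 1/42` forces `(x, w_y, r) = (F′, N′, 1/72)` —
the `(p, ρ) = (11, 1/72)` configuration `N′ ↦ F′` of the notes (treated there by REMARK (4)); every other difference of `U`-weights
is `0` or `≥ 1/36` (notes §0 `R♮`, §3 (iv)). [cite: AbramovichTemkinWlodarczyk2024, §5] -/
theorem feeder_single_U {r x y : ℚ} (hr0 : 0 < r) (hr : r ≤ 1/42) (hx : x ∈ U) (hy : y ∈ U) (h : x = y - r) :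
    x = 5/24 ∧ y = 2/9 ∧ r = 1/72 := by
  rcases mem_U.mp hx with rfl | rfl | rfl | rfl | rfl <;> rcases mem_U.mp hy with rfl | rfl | rfl | rfl | rfl <;>
    first | exact ⟨rfl, rfl, by linarith⟩ | (exfalso; linarith)

/-- Shape "one `C⁻`-variable times ONE `U`-variable": `(c − r) + x = w_y − r`, i.e. `x = w_y − c`, is impossible for
`x, w_y, c ∈ U`, `w_y ≠ c`, `c ∈ {F′, N′}` (the differences `1/72, 1/36, 1/24, 1/9, 1/8, 7/24, 5/18, …` are not `U`-weights)
(notes §3 (iv); replaces the notes' incorrect inequality `2/9 − ρ + 5/24 > 1/2 − ρ`). [cite: AbramovichTemkinWlodarczyk2024, §5] -/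
theorem feeder_Cminus_U {r c x y : ℚ} (hc : c = 5/24 ∨ c = 2/9) (hx : x ∈ U) (hy : y ∈ U) (hyc : y ≠ c) :
    (c - r) + x ≠ y - r := by
  rcases hc with rfl | rfl <;> rcases mem_U.mp hx with rfl | rfl | rfl | rfl | rfl <;>
    rcases mem_U.mp hy with rfl | rfl | rfl | rfl | rfl <;> first | exact absurd rfl hyc | (intro h; linarith)

/-- Shape "one `C⁻`-variable times `≥ 2` `U`-variables": too heavy — `(c − r) + Σ ≥ (c − r) + 5/12 > 1/2 − r ≥ w_y − r`
(`c ∈ U`) (notes §3 (iv)). [cite: AbramovichTemkinWlodarczyk2024, §5] -/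
theorem feeder_Cminus_UU {r c y : ℚ} (hc : c ∈ U) (hy : y ∈ U) {ι : Type*} (s : Finset ι) (f : ι → ℚ) (h2 : 2 ≤ s.card)
    (hf : ∀ i ∈ s, f i ∈ U) : y - r < (c - r) + ∑ i ∈ s, f i := by
  have h1 := Finset.card_nsmul_le_sum s f (5/24) fun i hi => U_ge (hf i hi)
  rw [nsmul_eq_mul] at h1
  have h2' : (2 : ℚ) ≤ s.card := by exact_mod_cast h2
  have := U_ge hc
  have := U_le hy
  nlinarith

/-- Shape "two `U`-variables only": `x + x′ = w_y − r` forces `r = 0` or `r ≥ 1/36`; impossible for `0 < r ≤ 1/42`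
(notes §3 (iv): "`F′F′` needs `ρ = 1/12`, `F′N′` `5/72`, … all need `ρ ≥ 1/36`"). [cite: AbramovichTemkinWlodarczyk2024, §5] -/
theorem feeder_UU {r x x' y : ℚ} (hr0 : 0 < r) (hr : r ≤ 1/42) (hx : x ∈ U) (hx' : x' ∈ U) (hy : y ∈ U) : x + x' ≠ y - r := by
  rcases mem_U.mp hx with rfl | rfl | rfl | rfl | rfl <;> rcases mem_U.mp hx' with rfl | rfl | rfl | rfl | rfl <;>
    rcases mem_U.mp hy with rfl | rfl | rfl | rfl | rfl <;> intro h <;> linarith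

/-- Shape "`≥ 3` `U`-variables only": too heavy (`≥ 5/8 > 1/2 − r`) (notes §3 (iv)). [cite: AbramovichTemkinWlodarczyk2024, §5] -/
theorem feeder_UUU {r y : ℚ} (hr0 : 0 < r) (hy : y ∈ U) {ι : Type*} (s : Finset ι) (f : ι → ℚ) (h3 : 3 ≤ s.card)
    (hf : ∀ i ∈ s, f i ∈ U) : y - r < ∑ i ∈ s, f i := by
  have h1 := Finset.card_nsmul_le_sum s f (5/24) fun i hi => U_ge (hf i hi)
  rw [nsmul_eq_mul] at h1
  have h3' : (3 : ℚ) ≤ s.card := by exact_mod_cast h3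
  have := U_le hy
  nlinarith

/-! ## §4 (iv) Feeders of a dense class `w ∈ (1/6, 1/5]` (variables weigh `≥ w − r`, at most one of them `< w`) -/

/-- `k` variables of weight `≥ w − r`, at most one of them lighter than `w`, weigh `≥ k·w − r` (`r ≥ 0`) (notes §4 (iv)).
[cite: AbramovichTemkinWlodarczyk2024, §5] -/
theorem sum_ge_card_mul_sub {w r : ℚ} (hr : 0 ≤ r) {ι : Type*} (s : Finset ι) (f : ι → ℚ) (hf : ∀ i ∈ s, w - r ≤ f i)
    (hone : ∀ i ∈ s, ∀ j ∈ s, f i < w → f j < w → i = j) : (s.card : ℚ) * w - r ≤ ∑ i ∈ s, f i := by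
  classical
  by_cases h : ∃ i ∈ s, f i < w
  · obtain ⟨i, hi, hfi⟩ := h
    have hrest : ∀ j ∈ s.erase i, w ≤ f j := fun j hj => by
      by_contra hlt
      exact (Finset.mem_erase.mp hj).1 (hone j (Finset.mem_of_mem_erase hj) i hi (not_le.mp hlt) hfi)
    have h1 := Finset.card_nsmul_le_sum (s.erase i) f w hrest
    rw [nsmul_eq_mul, Finset.card_erase_of_mem hi] at h1
    rw [← Finset.add_sum_erase s f hi]
    have hcard : 1 ≤ s.card := Finset.card_pos.mpr ⟨i, hi⟩
    have hc : ((s.card - 1 : ℕ) : ℚ) = s.card - 1 := by rw [Nat.cast_sub hcard, Nat.cast_one]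
    rw [hc] at h1
    have := hf i hi
    linarith
  · push Not at h
    have h1 := Finset.card_nsmul_le_sum s f w h
    rw [nsmul_eq_mul] at h1
    linarith

/-- **`M` cannot feed a dense class `w > 1/6`**: `k ≥ 2` such variables weigh `≥ 2w − r > 1/3 − r` (and one variable is excluded by
`not_slotWt_third_sub`) (notes §4 (iv)). [cite: AbramovichTemkinWlodarczyk2024, §5] -/
theorem M_feed_lt_sum {w r : ℚ} (hw : 1/6 < w) (hr : 0 ≤ r) {ι : Type*} (s : Finset ι) (f : ι → ℚ) (h2 : 2 ≤ s.card)
    (hf : ∀ i ∈ s, w - r ≤ f i) (hone : ∀ i ∈ s, ∀ j ∈ s, f i < w → f j < w → i = j) : 1/3 - r < ∑ i ∈ s, f i := by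
  have h1 := sum_ge_card_mul_sub hr s f hf hone
  have h2' : (2 : ℚ) ≤ s.card := by exact_mod_cast h2
  nlinarith

/-- **`V` cannot feed a dense class `w ∈ (1/6, 1/5]` with two variables**: `a + b = 1/2 − r` is impossible for legal `a, b ≥ w − r`
(both dense: `≤ 2/5`; one in `U`: the other would be `7/24 − r, 5/18 − r, 1/4 − r` (illegal), `1/6 − r < w − r`, or `−r`)
(notes §4 (iv)). [cite: AbramovichTemkinWlodarczyk2024, §5] -/
theorem V_feed_pair_ne {u w r a b : ℚ} (hw : 1/6 < w) (hr0 : 0 < r) (hr : r ≤ 1/42) (ha : SlotWt u a) (hb : SlotWt u b)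
    (haw : w - r ≤ a) (hbw : w - r ≤ b) : a + b ≠ 1/2 - r := by
  intro h
  rcases ha with ⟨_, ha2⟩ | ha <;> rcases hb with ⟨_, hb2⟩ | hb
  · linarith
  · rcases mem_U.mp hb with rfl | rfl | rfl | rfl | rfl <;> linarith
  · rcases mem_U.mp ha with rfl | rfl | rfl | rfl | rfl <;> linarith
  · rcases mem_U.mp ha with rfl | rfl | rfl | rfl | rfl <;> rcases mem_U.mp hb with rfl | rfl | rfl | rfl | rfl <;> linarith

/-- **`V` cannot feed a dense class `w > 1/6` with `k ≥ 3` variables**: they weigh `≥ 3w − r > 1/2 − r` (notes §4 (iv)).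
[cite: AbramovichTemkinWlodarczyk2024, §5] -/
theorem V_feed_lt_sum {w r : ℚ} (hw : 1/6 < w) (hr : 0 ≤ r) {ι : Type*} (s : Finset ι) (f : ι → ℚ) (h3 : 3 ≤ s.card)
    (hf : ∀ i ∈ s, w - r ≤ f i) (hone : ∀ i ∈ s, ∀ j ∈ s, f i < w → f j < w → i = j) : 1/2 - r < ∑ i ∈ s, f i := by
  have h1 := sum_ge_card_mul_sub hr s f hf hone
  have h3' : (3 : ℚ) ≤ s.card := by exact_mod_cast h3
  nlinarith

/-! ## §5 Order bounds on `R₇`: the shapes of the `D`-terms of `M` and `V` -/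

/-- **`M`-terms, two factors**: `x + y = 1/3 − r` with legal `x, y` forces both DENSE (a `U`-cofactor would leave `1/8 − r`,
`1/9 − r`, `1/12 − r` or less, `< u`) — needs `1/7 ≤ u ≤ 1/5`, `0 < r` (notes §5). [cite: AbramovichTemkinWlodarczyk2024, §5] -/
theorem M_term_pair_dense {u r x y : ℚ} (hu : 1/7 ≤ u) (hu5 : u ≤ 1/5) (hr0 : 0 < r) (hx : SlotWt u x) (hy : SlotWt u y)
    (h : x + y = 1/3 - r) : (u ≤ x ∧ x ≤ 1/5) ∧ (u ≤ y ∧ y ≤ 1/5) := by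
  have hx' := le_of_slotWt hu5 hx
  have hy' := le_of_slotWt hu5 hy
  rcases hx with hx | hx <;> rcases hy with hy | hy
  · exact ⟨hx, hy⟩
  · exfalso; rcases mem_U.mp hy with rfl | rfl | rfl | rfl | rfl <;> linarith
  · exfalso; rcases mem_U.mp hx with rfl | rfl | rfl | rfl | rfl <;> linarith
  · exfalso; rcases mem_U.mp hx with rfl | rfl | rfl | rfl | rfl <;> linarith [U_ge hy]

/-- **`M`-terms, `k ≥ 3` factors: impossible** (`≥ 3u ≥ 3/7 > 1/3 − r`) (notes §5). [cite: AbramovichTemkinWlodarczyk2024, §5] -/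
theorem M_term_lt_sum {u r : ℚ} (hu : 1/7 ≤ u) (hu5 : u ≤ 1/5) (hr0 : 0 < r) {ι : Type*} (s : Finset ι) (f : ι → ℚ)
    (h3 : 3 ≤ s.card) (hf : ∀ i ∈ s, SlotWt u (f i)) : 1/3 - r < ∑ i ∈ s, f i := by
  have h1 := card_mul_le_sum hu5 s f hf
  have h3' : (3 : ℚ) ≤ s.card := by exact_mod_cast h3
  nlinarith

/-- **`V`-terms, two factors**: `x + y = 1/2 − r` with legal `x, y` forces `{x, y} = {M, 1/6 − r}` (notes §5: "`M′·x`").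
[cite: AbramovichTemkinWlodarczyk2024, §5] -/
theorem V_term_pair {u r x y : ℚ} (hu : 1/7 ≤ u) (hu5 : u ≤ 1/5) (hr0 : 0 < r) (hr : r ≤ 1/42) (hx : SlotWt u x)
    (hy : SlotWt u y) (h : x + y = 1/2 - r) : (x = 1/3 ∧ y = 1/6 - r) ∨ (y = 1/3 ∧ x = 1/6 - r) := by
  have hx' := le_of_slotWt hu5 hx
  have hy' := le_of_slotWt hu5 hy
  rcases hx with hx | hx <;> rcases hy with hy | hy
  · exfalso; linarith [hx.2, hy.2]
  · rcases mem_U.mp hy with rfl | rfl | rfl | rfl | rfl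
    · exfalso; linarith [hx.2]
    · exfalso; linarith [hx.2]
    · exfalso; linarith [hx.2]
    · exact Or.inr ⟨rfl, by linarith⟩
    · exfalso; linarith
  · rcases mem_U.mp hx with rfl | rfl | rfl | rfl | rfl
    · exfalso; linarith [hy.2]
    · exfalso; linarith [hy.2]
    · exfalso; linarith [hy.2]
    · exact Or.inl ⟨rfl, by linarith⟩
    · exfalso; linarith
  · exfalso
    rcases mem_U.mp hx with rfl | rfl | rfl | rfl | rfl <;> rcases mem_U.mp hy with rfl | rfl | rfl | rfl | rfl <;> linarith

/-- **`V`-terms, three factors**: if one factor is a `U`-slot it is `F′ = 5/24` and the other two are dense (with sum `7/24 − r`);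
`N′·a·b`, `W·a·b`, `M′·a·b`, two `U`-factors are weight-infeasible on `R₇` (notes §5). Apply with the factors in any order.
[cite: AbramovichTemkinWlodarczyk2024, §5] -/
theorem V_term_triple {u r x y z : ℚ} (hu : 1/7 ≤ u) (hu5 : u ≤ 1/5) (hr0 : 0 < r) (hx : SlotWt u x) (hy : SlotWt u y)
    (hz : SlotWt u z) (h : x + y + z = 1/2 - r) (hxU : x ∈ U) : x = 5/24 ∧ (u ≤ y ∧ y ≤ 1/5) ∧ (u ≤ z ∧ z ≤ 1/5) := by
  have hy' := le_of_slotWt hu5 hy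
  have hz' := le_of_slotWt hu5 hz
  have hyz : ∀ {a b : ℚ}, SlotWt u a → SlotWt u b → u ≤ a → u ≤ b → x + a + b = 1/2 - r →
      x = 5/24 ∧ (u ≤ a ∧ a ≤ 1/5) ∧ (u ≤ b ∧ b ≤ 1/5) := by
    intro a b ha hb ha' hb' hab
    rcases ha with ha | ha
    · rcases hb with hb | hb
      · refine ⟨?_, ha, hb⟩
        rcases mem_U.mp hxU with rfl | rfl | rfl | rfl | rfl
        · rfl
        all_goals exfalso; linarith
      · exfalso
        rcases mem_U.mp hxU with rfl | rfl | rfl | rfl | rfl <;> linarith [U_ge hb]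
    · exfalso
      rcases mem_U.mp hxU with rfl | rfl | rfl | rfl | rfl <;> linarith [U_ge ha]
  exact hyz hy hz hy' hz' h

/-- **`V`-terms, `k ≥ 4` factors: impossible** (`≥ 4u ≥ 4/7 > 1/2 − r`) (notes §5). [cite: AbramovichTemkinWlodarczyk2024, §5] -/
theorem V_term_lt_sum {u r : ℚ} (hu : 1/7 ≤ u) (hu5 : u ≤ 1/5) (hr0 : 0 < r) {ι : Type*} (s : Finset ι) (f : ι → ℚ)
    (h4 : 4 ≤ s.card) (hf : ∀ i ∈ s, SlotWt u (f i)) : 1/2 - r < ∑ i ∈ s, f i := by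
  have h1 := card_mul_le_sum hu5 s f hf
  have h4' : (4 : ℚ) ≤ s.card := by exact_mod_cast h4
  nlinarith

/-- The dense factor `1/6 − r` of a `V`-term `M′·x` is legal only if `u + r ≤ 1/6`, i.e. `ρ ≤ 1/(6(p+1))` (remark to notes §5).
[cite: AbramovichTemkinWlodarczyk2024, §5] -/
theorem V_term_pair_legal_iff {u r : ℚ} (hr0 : 0 < r) (hr : r ≤ 1/42) : SlotWt u (1/6 - r) ↔ u + r ≤ 1/6 := by
  constructor
  · rintro (⟨h1, _⟩ | h)
    · linarith
    · exfalso; rcases mem_U.mp h with h | h | h | h | h <;> linarith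
  · intro h; exact Or.inl ⟨by linarith, by linarith⟩

/-- Order-bound identity for `M`: `1 + (1/3 − r − 2pr)/r = 1/(3r) − 2p` (notes §5). [cite: AbramovichTemkinWlodarczyk2024, §5] -/
theorem orderBound_M {p r : ℚ} (hr : r ≠ 0) : 1 + (1/3 - r - 2 * p * r) / r = 1 / (3 * r) - 2 * p := by
  field_simp
  ring

/-- Order-bound identities for `V`, entries 1 and 2: both equal `1/(2r) − 3p` after `+1` (notes §5). [cite: AbramovichTemkinWlodarczyk2024, §5] -/
theorem orderBound_V₁₂ {p r : ℚ} (hr : r ≠ 0) :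
    1 + (1 / (3 * r) - 2 * p + (1/6 - r - p * r) / r) = 1 / (2 * r) - 3 * p ∧
    1 + (1/2 - r - 3 * p * r) / r = 1 / (2 * r) - 3 * p := by
  constructor <;> field_simp <;> ring

/-- Order-bound for `V`, entry 3: `1 + (7/24 − r − 2pr)/r ≤ 1/(2r) − 3p` iff `r ≤ 5/(24p)`, true for `r ≤ 1/(6p)` (notes §5).
[cite: AbramovichTemkinWlodarczyk2024, §5] -/
theorem orderBound_V₃ {p r : ℚ} (hp : 0 < p) (hr : 0 < r) (h6 : r ≤ 1 / (6 * p)) :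
    1 + (7/24 - r - 2 * p * r) / r ≤ 1 / (2 * r) - 3 * p := by
  rw [le_div_iff₀ (by positivity)] at h6
  have key : (1 / (2 * r) - 3 * p) - (1 + (7/24 - r - 2 * p * r) / r) = 5 / (24 * r) - p := by
    field_simp
    ring
  have hp5 : p ≤ 5 / (24 * r) := by
    rw [le_div_iff₀ (by positivity)]
    nlinarith
  linarith

/-- `e ≥ 2` is excluded on `R₇`: `p² r ≥ p/7 ≥ 1` (`> 1/2 ≥ w*`) for `p ≥ 7`, `r ≥ 1/(7p)` (notes §5). [cite: AbramovichTemkinWlodarczyk2024, §5] -/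
theorem one_le_sq_mul {p r : ℚ} (hp : 7 ≤ p) (h1 : 1 / (7 * p) ≤ r) : 1 ≤ p ^ 2 * r := by
  have hp0 : 0 < p := by linarith
  rw [div_le_iff₀ (by positivity)] at h1
  nlinarith

/-! ## §5 Deficits and the count `Σ o ≤ p − 1` -/

/-- The four kinds of factors of a value-`1` monomial of `g` in §5: a `D`-constant slot of weight `w`, a dense mover of weight `x`
(`u ≤ x ≤ 1/6`), an `M`-slot, a `V`-slot (notes §5). [cite: AbramovichTemkinWlodarczyk2024, §5] -/
inductive Kind where
  /-- a `D`-constant slot of weight `w` (`F′, N′, W`, dense classes `> 1/6`: THEOREM K6). [cite: AbramovichTemkinWlodarczyk2024, §5] -/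
  | const (w : ℚ)
  /-- a dense mover of weight `x`, `u ≤ x ≤ 1/6`. [cite: AbramovichTemkinWlodarczyk2024, §5] -/
  | dense (x : ℚ)
  /-- an `M`-slot (`1/3`). [cite: AbramovichTemkinWlodarczyk2024, §5] -/
  | M
  /-- a `V`-slot (`1/2`). [cite: AbramovichTemkinWlodarczyk2024, §5] -/
  | V

/-- Weight of a factor kind. [cite: AbramovichTemkinWlodarczyk2024, §5] -/
def Kind.wt : Kind → ℚ
  | .const w => w
  | .dense x => x
  | .M => 1/3
  | .V => 1/2

/-- The §5 ORDER BOUNDS: `0`, `(x − pr)/r`, `1/(3r) − 2p`, `1/(2r) − 3p`. [cite: AbramovichTemkinWlodarczyk2024, §5] -/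
def Kind.bound (p r : ℚ) : Kind → ℚ
  | .const _ => 0
  | .dense x => (x - p * r) / r
  | .M => 1 / (3 * r) - 2 * p
  | .V => 1 / (2 * r) - 3 * p

/-- Legality of a factor kind: constant slots have positive weight; dense movers weigh `u = pr ≤ x ≤ 1/6`. [cite: AbramovichTemkinWlodarczyk2024, §5] -/
def Kind.Legal (p r : ℚ) : Kind → Prop
  | .const w => 0 < w
  | .dense x => p * r ≤ x ∧ x ≤ 1/6
  | .M => True
  | .V => True

/-- **DEFICITS** (notes §5): `bound ≤ w/r − 6p·w`, i.e. `φ(f) = w_f/ρ − o(f) ≥ 6p·w_f`, for every legal kind (`0 < r`, `pr ≤ 1/6`).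
[cite: AbramovichTemkinWlodarczyk2024, §5] -/
theorem deficit {p r : ℚ} (hp : 0 < p) (hr : 0 < r) (h6 : p * r ≤ 1/6) :
    ∀ K : Kind, K.Legal p r → K.bound p r ≤ K.wt / r - 6 * p * K.wt
  | .const w, hw => by
      simp only [Kind.bound, Kind.wt, Kind.Legal] at *
      rw [div_eq_mul_one_div]
      have h1 : 6 * p ≤ 1 / r := by rw [le_div_iff₀ hr]; linarith
      nlinarith
  | .dense x, hx => by
      simp only [Kind.bound, Kind.wt, Kind.Legal] at *
      rw [sub_div, mul_div_cancel_right₀ p hr.ne']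
      nlinarith [mul_nonneg hp.le (sub_nonneg.mpr hx.2)]
  | .M, _ => by
      simp only [Kind.bound, Kind.wt]
      rw [div_div]
      linarith
  | .V, _ => by
      simp only [Kind.bound, Kind.wt]
      rw [div_div]
      linarith

/-- **COUNT, rational form** (notes §5): legal factors with weights summing to `1` and orders within the bounds have
`Σ o ≤ 1/r − 6p ≤ p` on `R₇`. [cite: AbramovichTemkinWlodarczyk2024, §5] -/
theorem order_sum_le {ι : Type*} (s : Finset ι) (K : ι → Kind) (o : ι → ℕ) {p r : ℚ} (hp : 0 < p) (h7 : 1 / (7 * p) ≤ r)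
    (h6 : r ≤ 1 / (6 * p)) (hL : ∀ i ∈ s, (K i).Legal p r) (hw : ∑ i ∈ s, (K i).wt = 1)
    (ho : ∀ i ∈ s, (o i : ℚ) ≤ (K i).bound p r) : (∑ i ∈ s, (o i : ℚ)) ≤ 1 / r - 6 * p ∧ 1 / r - 6 * p ≤ p := by
  have hr : 0 < r := lt_of_lt_of_le (by positivity) h7
  have h6' : p * r ≤ 1/6 := by rw [le_div_iff₀ (by positivity)] at h6; linarith
  have h7' : 1 / r ≤ 7 * p := by
    rw [div_le_iff₀ (by positivity)] at h7
    rw [div_le_iff₀ hr]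
    linarith
  refine ⟨?_, by linarith⟩
  calc (∑ i ∈ s, (o i : ℚ)) ≤ ∑ i ∈ s, ((K i).wt / r - 6 * p * (K i).wt) :=
        Finset.sum_le_sum fun i hi => (ho i hi).trans (deficit hp hr h6' _ (hL i hi))
    _ = (∑ i ∈ s, (K i).wt) / r - 6 * p * ∑ i ∈ s, (K i).wt := by
        rw [Finset.sum_sub_distrib, Finset.sum_div, Finset.mul_sum]
    _ = 1 / r - 6 * p := by rw [hw, mul_one]

/-- **COUNT, integer form: `Σ o ≤ p − 1`** for `p` prime `≥ 7` on `R₇` (notes §5, incl. the endpoint `r = 1/(7p)`: equality would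
force every factor tight — a constant factor needs `r = 1/(6p)`, a dense mover `x = 1/6` with `o = p/6`, `M` `o = p/3`, `V` `o = p/2`,
none an integer).  With LEMMA C (`R_n g ≠ 0` needs `Σ o ≥ n ≥ p`) every carry vanishes. [cite: AbramovichTemkinWlodarczyk2024, §5] -/
theorem order_sum_le_pred {ι : Type*} (s : Finset ι) (K : ι → Kind) (o : ι → ℕ) {p : ℕ} (hp : p.Prime) (hp7 : 7 ≤ p) {r : ℚ}
    (h7 : 1 / (7 * (p : ℚ)) ≤ r) (h6 : r ≤ 1 / (6 * (p : ℚ))) (hL : ∀ i ∈ s, (K i).Legal p r)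
    (hw : ∑ i ∈ s, (K i).wt = 1) (ho : ∀ i ∈ s, (o i : ℚ) ≤ (K i).bound p r) : ∑ i ∈ s, o i ≤ p - 1 := by
  have hp0 : (0 : ℚ) < p := by exact_mod_cast hp.pos
  have hr : 0 < r := lt_of_lt_of_le (by positivity) h7
  have h6' : (p : ℚ) * r ≤ 1/6 := by rw [le_div_iff₀ (by positivity)] at h6; linarith
  obtain ⟨hle, hle'⟩ := order_sum_le s K o hp0 h7 h6 hL hw ho
  have hcast : ((∑ i ∈ s, o i : ℕ) : ℚ) = ∑ i ∈ s, (o i : ℚ) := Nat.cast_sum s o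
  suffices hne : ∑ i ∈ s, o i ≠ p by
    have hq : ((∑ i ∈ s, o i : ℕ) : ℚ) ≤ (p : ℚ) := by rw [hcast]; exact hle.trans hle'
    have : ∑ i ∈ s, o i ≤ p := by exact_mod_cast hq
    omega
  intro heq
  have heq' : (∑ i ∈ s, (o i : ℚ)) = p := by rw [← hcast, heq]
  -- the slacks are nonnegative and sum to `1/r − 7p ≤ 0`, hence all vanish and `1/r = 7p`
  have hsl0 : ∀ i ∈ s, 0 ≤ (K i).wt / r - 6 * p * (K i).wt - o i := fun i hi => by
    linarith [ho i hi, deficit hp0 hr h6' _ (hL i hi)]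
  have hsum : ∑ i ∈ s, ((K i).wt / r - 6 * p * (K i).wt - o i) = 1 / r - 6 * p - p := by
    rw [Finset.sum_sub_distrib, Finset.sum_sub_distrib, ← Finset.sum_div, ← Finset.mul_sum, hw, heq', mul_one]
  have h0 : ∑ i ∈ s, ((K i).wt / r - 6 * p * (K i).wt - o i) = 0 :=
    le_antisymm (by rw [hsum]; linarith) (Finset.sum_nonneg hsl0)
  have hr7 : 1 / r = 7 * p := by linarith [Finset.sum_nonneg hsl0]
  have hall := (Finset.sum_eq_zero_iff_of_nonneg hsl0).mp h0
  obtain ⟨i, hi⟩ : s.Nonempty := by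
    by_contra h
    rw [Finset.not_nonempty_iff_eq_empty] at h
    rw [h, Finset.sum_empty] at hw
    exact zero_ne_one hw
  have hi0 := hall i hi
  have hoi := ho i hi
  have hLi := hL i hi
  have ho0 : (0 : ℚ) ≤ o i := Nat.cast_nonneg _
  rcases hK : K i with w | x | _ | _ <;> rw [hK] at hi0 hoi hLi <;>
    simp only [Kind.wt, Kind.bound, Kind.Legal] at hi0 hoi hLi
  · -- constant factor: `o = 0`, `w/r = 6pw`, but `1/r = 7p` and `pw > 0`
    have e : w / r = 7 * p * w := by rw [div_eq_mul_one_div, hr7]; ring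
    nlinarith [mul_pos hp0 hLi]
  · -- dense mover: `o = px`, `x = 1/6`, `6 o = p`
    have e1 : x / r = 7 * p * x := by rw [div_eq_mul_one_div, hr7]; ring
    have e2 : (x - p * r) / r = 7 * p * x - p := by rw [sub_div, mul_div_cancel_right₀ _ hr.ne', e1]
    rw [e2] at hoi
    rw [e1] at hi0
    have hpx : (p : ℚ) * x ≤ p * (1/6) := mul_le_mul_of_nonneg_left hLi.2 hp0.le
    have h6o : 6 * (o i : ℚ) = p := by linarith
    have hdvd : 6 ∣ p := ⟨o i, by exact_mod_cast h6o.symm⟩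
    rcases hp.eq_one_or_self_of_dvd 6 hdvd with h | h <;> omega
  · -- `M`: `3 o = p`
    have e : (1/3 : ℚ) / r = 7 * p / 3 := by rw [div_eq_mul_one_div, hr7]; ring
    rw [e] at hi0
    have h3o : 3 * (o i : ℚ) = p := by linarith
    have hdvd : 3 ∣ p := ⟨o i, by exact_mod_cast h3o.symm⟩
    rcases hp.eq_one_or_self_of_dvd 3 hdvd with h | h <;> omega
  · -- `V`: `2 o = p`
    have e : (1/2 : ℚ) / r = 7 * p / 2 := by rw [div_eq_mul_one_div, hr7]; ring
    rw [e] at hi0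
    have h2o : 2 * (o i : ℚ) = p := by linarith
    have hdvd : 2 ∣ p := ⟨o i, by exact_mod_cast h2o.symm⟩
    rcases hp.eq_one_or_self_of_dvd 2 hdvd with h | h <;> omega

/-- `p` prime `≥ 7` is not divisible by `2`, `3` or `6` (the endpoint integrality facts, stand-alone). [cite: AbramovichTemkinWlodarczyk2024, §5] -/
theorem not_dvd_of_prime {p : ℕ} (hp : p.Prime) (h7 : 7 ≤ p) : ¬ 2 ∣ p ∧ ¬ 3 ∣ p ∧ ¬ 6 ∣ p := by
  refine ⟨fun h => ?_, fun h => ?_, fun h => ?_⟩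
  · rcases hp.eq_one_or_self_of_dvd 2 h with h | h <;> omega
  · rcases hp.eq_one_or_self_of_dvd 3 h with h | h <;> omega
  · rcases hp.eq_one_or_self_of_dvd 6 h with h | h <;> omega

end PinWall

end Literature.AlgebraicGeometry.Resolution.WeightedBlowup
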